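import Literature.NumberTheory.Automorphic.BrandtMatrixClassFunction
import Literature.NumberTheory.Automorphic.BrandtOrderIdeals
import HarnessLib

/-!
# `U`-operators at the primes dividing the Eichler level, the full Hecke algebra `𝕋_{N⁺,N⁻}`,
# and the `N⁺`-new quotient of the Brandt module `ℤ[Cls O]`

Topic `NumberTheory/Automorphic`; definitions with bodies and proved lemmas (no named fact, no
instance, no `sorry`). Requested by the definition item `defn-BrandtEichlerLevelUOperatorsNewQuotient`
(bsd-stepL planner, RULING 21 (B); consumer: the "definite first floor" of W. Zhang's Thm. 7.2 at
`p = 3`, which pins a mod-`p` eigen-line by the FULL Hecke algebra of the Shimura set, W. Zhang,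
Camb. J. Math. 2 (2014), §3.9 and (4.8)). Written over the tree's Brandt layer
`Literature/NumberTheory/Automorphic/BrandtXi.lean` (`Brandt.IsEichlerOrder`, `Brandt.ClassSet`,
`Brandt.matrix` = Voight's `T(n)`, `Brandt.XiSetup N⁺ N⁻`).

## The printed objects

* **The Shimura set and its Hecke algebra.** For a definite quaternion algebra `B` over `ℚ` of
  discriminant `N⁻` and an Eichler order `R` of level `N⁺`, the Shimura set is
  `X_{N⁺,N⁻} = Bˣ \ B(𝔸_f)ˣ / R̂ˣ` (W. Zhang 2014, §3.1, p. 204; Bertolini–Darmon 2001, §4.1,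
  p. 142: `Y = Bˣ \ B̂ˣ / R̂₀ˣ`), and `𝕋_{N⁺,N⁻}` is "the Hecke algebra generated over `ℤ` by Hecke
  operators `T_ℓ`, `(ℓ, N) = 1` and `U_ℓ` for `ℓ ∣ N` acting on `ℤ[X]`" (W. Zhang 2014, §3.9
  p. 214 and §6.1 p. 226; for `ℓ ∣ N⁻` the operator `U_ℓ` is the involution induced by a
  uniformiser of `B_ℓ`, loc. cit.), equivalently the `N⁻`-new quotient of the Hecke algebra of
  level `N = N⁺N⁻` (Pollack–Weston 2011, §2.1). By `B(𝔸_f)ˣ / R̂ˣ = ` {invertible right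
  `R`-ideals} (`x ↦ x R̂ ∩ B`, Voight Main Thm. 16.6.1 / 27.6), `ℤ[X] = ℤ[Cls R]` is the Brandt
  module of the tree, and a Hecke operator `[R̂ˣ g R̂ˣ]` (`g ∈ R̂`) is the correspondence
  `[I] ↦ Σ [J]` over the sub-ideals `J = x g_i R̂ ∩ B ⊆ I` attached to the right cosets
  `g_i R̂ˣ ⊆ R̂ˣ g R̂ˣ`. For `(n, N⁺) = 1` this gives all sub-ideals of reduced norm `n · nrd I`,
  i.e. the Brandt matrix `T(n)` (Voight (41.1.1), Pizer 1980 §2; tree: `Brandt.matrix`).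
* **Orientations and `U_ℓ` at `ℓ ∣ N⁺`.** At `ℓ ∣ N⁺`, `ℓ^e ∥ N⁺`, an Eichler order is locally
  `R_ℓ = End(L₁) ∩ End(L₂) = (ℤ_ℓ ℤ_ℓ; ℓ^e ℤ_ℓ ℤ_ℓ)` for lattices `L₁ = ℤ_ℓ² ⊋ L₂ = ⟨e₁, ℓ^e e₂⟩`
  (Vignéras, LNM 800, II §2 Thm. 2.3 (2), Lemme 2.4; Voight 23.4.3, 23.4.12; tree:
  `exists_eichler_model`, `IsEichlerOrder.exists_conjUnit_localAt_iff_eichler`), and a local right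
  `R_ℓ`-ideal `x R_ℓ` is the PAIR of lattices `(x L₁, x L₂)` (tree: `EichlerEmbeddingLocalLevel`,
  "a local ideal `x O_(q)` is the pair `(Φ(x) ℤ_q², Φ(x) Λ₁⁰)`"); for `e = 1` this is an ORIENTED
  EDGE of the Bruhat–Tits tree, whose stabiliser is the level-`ℓ` Eichler order
  `{c ≡ 0 (mod ℓ)}` (Bertolini–Darmon 2001, §3.1, p. 127). The two ends `End(L₁)`, `End(L₂)`
  of the pair are interchanged by the Atkin–Lehner normaliser `(0 1; ℓ^e 0)`; singling one out is
  an **orientation** of `R` at `ℓ` (Bertolini–Darmon 1999, §2, p. 267: "an Eichler order … is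
  said to be oriented if it is equipped with a surjective algebra homomorphism
  `ι : R → ℤ/Nℤ`"; Gross 1987 §3) — globally: an ORDERED pair of maximal orders `(O₁, O₂)` with
  `R = O₁ ∩ O₂` (the tree's `IsEichlerOrder` provides such a pair existentially). The operator
  `U_ℓ` is the double coset of `diag(1, ℓ)_ℓ` in this model (the classical
  `U_ℓ = [Γ₀(N) diag(1,ℓ) Γ₀(N)]`): its `ℓ` right cosets move the pair `(L₁, L₂)` to the pairs
  `(L₂ + ℓ L₁, M)` with `M ⊊ L₂` of index `ℓ`, `M ≠ ℓ (L₂ + ℓ^{e-1} L₁)` — the geodesic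
  `[L₁] → [L₂]` pushed one step FORWARD; on edges this is Bertolini–Darmon's
  `U_p(e) = {e' : source(e') = target(e), e' ≠ ē}` (BD 2001 §4.1, pp. 142–144, the
  `U_p`-correspondence on `E⃗(𝒯)` and its `α_p`-distribution relation). The opposite orientation
  `(O₂, O₁)` gives the double coset of `diag(ℓ, 1)`, conjugate to `U_ℓ` by Atkin–Lehner.

## The ideal-theoretic form used here (derivation; not printed in this form)

Fix the orientation `(O₁, O₂)`, `O = O₁ ∩ O₂`, and put
`𝒯 = link O₁ O₂ = {x ∈ O₁ | x O₁ ⊆ O₂}`; locally `𝒯_ℓ = Hom(L₁, L₂)`, `𝒯_q = O_q` at `q ∤ N⁺`.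
For an invertible right `O`-ideal `I` (`I_ℓ = α O_ℓ ↔ (M₁, M₂) = (α L₁, α L₂)`) and a sub-ideal
`J ⊆ I` of index `ℓ²` (`J_ℓ = β O_ℓ ↔ (M₁', M₂')`, `M_i' ⊊ M_i` of index `ℓ`, `J_q = I_q` for
`q ≠ ℓ`) one has `(J 𝒯)_ℓ = Hom(L₁, M₂')` and `(I O₁)_ℓ = Hom(L₁, M₁)`, so
`J 𝒯 ⊆ ℓ · I O₁ ⟺ M₂' ⊆ ℓ M₁` (the inclusion is automatic at `q ≠ ℓ` since `𝒯 ⊆ O₁`).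
Listing the sub-ideals of index `ℓ²` for `e ≥ 1` — `ℓ` forward ones (`M₁' = M₂ + ℓ M₁`,
`M₂'` beyond `M₂`), `ℓ` backward ones (`M₂' = ℓ (M₂ + ℓ^{e-1} M₁)`), and for `e = 1` one more,
the Atkin–Lehner translate `(M₂, ℓ M₁)` — exactly the forward ones satisfy `M₂' ⊄ ℓ M₁`. Hence

  **`J` is a `U_ℓ`-sub-ideal of `I` iff `[I : J] = ℓ²` and `J · link(O₁, O₂) ⊄ ℓ · (I O₁)`**

(`Brandt.IsForward`), and `U_ℓ` is the matrix `Brandt.uMatrix O O₁ O₂ ℓ` counting them class by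
class, in the convention of `Brandt.matrix` (entry `(i, j)` = number of forward sub-ideals of
`I_j` in the class `i`; it acts on divisor vectors by `Matrix.mulVec`, on functions
`Cls O → ℤ` by `Matrix.vecMul`). Consequences recorded for orientation: `T(ℓ) = U_ℓ + V_ℓ`
(`+ W_ℓ` if `ℓ ∥ N⁺`) with `V_ℓ = uMatrix O O₂ O₁ ℓ` — so Pizer's Brandt matrix `B(ℓ)` at
`ℓ ∣ N⁺` is NOT `U_ℓ`; and at `ℓ ∤ N⁺` (where `𝒯_ℓ = O_ℓ`) every sub-ideal of index `ℓ²` is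
forward, so `uMatrix O O₁ O₂ ℓ = Brandt.matrix O ℓ` there (in particular `U_q = W_q` at
`q ∣ N⁻`). These two identities are local computations NOT proved in this file (only
`uMatrix ≤ matrix` entrywise is); the commutation `U_ℓ T_n = T_n U_ℓ`, `U_ℓ U_ℓ' = U_ℓ' U_ℓ` and
the commutativity of the full algebra are proved in the sequel
`BrandtEichlerLevelUOperatorsCommute.lean`.

## Level lowering at `ℓ` and the `N⁺`-new quotient

The two Eichler orders of level `N⁺/ℓ` containing `O = O₁ ∩ O₂` are obtained by retracting one
end of the geodesic at `ℓ`: `O₂⁺ = End(L₂ + ℓ^{e-1} L₁)` is the left order of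
`Hom(L₁, L₂ + ℓ^{e-1}L₁) = O₁ ∩ ℓ⁻¹ 𝒯` (locally; globally this lattice is `𝒯` away from `ℓ`, whose
left order is `O₂`), whence the global definitions `Brandt.retract O₁ O₂ ℓ = O_L(O₁ ∩ ℓ⁻¹ link(O₁,O₂))`
(= `O₂` moved one step towards `O₁` at `ℓ`, unchanged elsewhere), `lowerRight = O₁ ∩ retract O₁ O₂ ℓ`
and `lowerLeft = retract O₂ O₁ ℓ ∩ O₂`. For an Eichler order `P ⊇ O` the degeneracy map
`Cls O → Cls P` is `[I] ↦ [I P]` (push-forward of the lattice pair: truncation of the geodesic);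
its transpose correspondence `[I'] ↦ Σ_{I P = I'} [I]` is `Brandt.degeneracyPull O P` (entry
`(i, i')` = number of right `O`-ideals `I` of class `i` with `I P = I'_{i'}`; classically the two
degeneracy maps `S₂(Γ₀(N⁺N⁻/ℓ)) ⇉ S₂(Γ₀(N⁺N⁻))`, cf. Bertolini–Darmon 1999 §2 p. 265 for the
modular-curve side, Ribet 1990 §3), `Brandt.degeneracyPush O P` is the indicator matrix of
`[I P] = i'`. The `ℓ`-OLD part of `ℤ^{Cls O}` is the span of the columns of the two pull-back
matrices (`Brandt.oldPart`), the `N⁺`-old submodule their sum over `ℓ ∣ N⁺` (`Brandt.oldSubmodule`),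
the **`N⁺`-new quotient** is `ℤ^{Cls O} / old` (`Brandt.NewQuotient`) and the `N⁺`-new submodule
is the common kernel of the push-forwards (`Brandt.newSubmodule`).

## Contents (namespace `Literature.NumberTheory.Automorphic.Brandt`)

* `link O₁ O₂`, `IsForward O₁ O₂ ℓ J I`, `subidealsWith P n I' I`, `matrixWith O P n` (a Brandt
  matrix filtered by a predicate `P J I` on (sub-ideal, ambient ideal); `matrixWith_true`:
  `P = ⊤` gives `Brandt.matrix`), `IsTranslationInvariant P` and `matrixWith_apply_eq_ncard`
  (independence of representatives), **`uMatrix O O₁ O₂ ℓ`** with `uMatrix_le_matrix`,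
  `uMatrix_apply_eq_ncard`;
* `divMul`, `retract`, `lowerLeft`, `lowerRight` (`inf_le_lowerLeft/Right`: they contain `O₁ ∩ O₂`;
  `isOrder_retract`);
* `underSet`, `degeneracyPull`, `degeneracyPush`, `oldPart`, `oldSubmodule`, `NewQuotient`,
  `newSubmodule` (`mem_newSubmodule_iff`), and prime by prime `oldSubmoduleAt`, `NewQuotientAt`,
  `newSubmoduleAt` (the `ℓ`-old submodule / `ℓ`-new quotient at ONE prime `ℓ`, appended on request of
  the consumer: the `3`-new quotient at `3 ∣ N⁺`);
* `heckeAt O O₁ O₂ N⁺ p` (`U_p` if `p ∣ N⁺`, else `T(p)`), **`fullHeckeAlgebra O O₁ O₂ N⁺`**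
  (`Algebra.adjoin ℤ` of the `heckeAt p`, `p` prime), `fullEigenLattice` (simultaneous integral
  eigenvectors of ALL `heckeAt p`; `fullEigenLattice_le_eigenLattice`);
* for a Brandt setup `S : XiSetup N⁺ N⁻`: the CHOSEN orientation `S.O₁`, `S.O₂`
  (`Classical.choose` on `S.isEichlerOrder`; `S.O_eq_inf : S.O = S.O₁ ⊓ S.O₂`,
  `S.relIndex_O_O₁`, `S.natCast_smul_mem_O : N⁺ O₁ ⊆ O`), and `S.uMatrix ℓ`, `S.heckeAt p`,
  `S.fullHeckeAlgebra ⊇` (by generators) the anemic `S.heckeAlgebra` of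
  `BrandtEigenAugmentation.lean`, `S.fullEigenLattice λ ≤ Brandt.eigenLattice (N⁺N⁻) (matrix S.O) λ`,
  `S.lowerLeft/lowerRight ℓ ⊇ S.O`, `S.oldSubmodule`, `S.NewQuotient`, `S.newSubmodule`.

## Design notes

* All definitions take the orientation `(O₁, O₂)` as explicit data and the order `O` whose class
  set is used as a separate argument (intended use: `O = O₁ ⊓ O₂`; nothing needs this
  definitionally, which avoids transporting `ClassSet` along the equation `S.O = S.O₁ ⊓ S.O₂`).
  Swapping `(O₁, O₂)` replaces `U_ℓ` by its Atkin–Lehner conjugate; any Jacquet–Langlands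
  isomorphism `ℤ[Cls O] ⊗ ℂ ≅ S₂(Γ₀(N⁺N⁻))^{N⁻-new} ⊕ Eis` can be composed with the Atkin–Lehner
  involution, so either orientation is "the" `U_ℓ` for a suitable such isomorphism; statements
  sensitive to the choice should quantify over `(O₁, O₂)` (use `Brandt.uMatrix`, not
  `XiSetup.uMatrix`).
* `(ℓ : ℤ) • S` is Mathlib's pointwise scalar action on `Submodule ℤ D`
  (`Submodule.pointwiseDistribMulAction`), `α • I` (`α ∈ Dˣ`) the left translation used throughout
  the Brandt files; products `I * P` are products of `ℤ`-submodules of the ring `D`.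
* Degenerate inputs (documented junk): `ℓ = 0` gives index `0` (infinite index) in
  `subidealsWith`, so `uMatrix O O₁ O₂ 0` counts nothing meaningful; `ℓ ∤ N⁺` gives `T(ℓ)` (see
  above); `Nplus = 0` makes `oldSubmodule = ⊥` (`Nat.primeFactors 0 = ∅`).
* What is NOT here: the Jacquet–Langlands comparison; multiplicity one of non-Eisenstein maximal
  ideals of `𝕋_{N⁺,N⁻}` on `ℤ[Cls O]` or on the new quotient (W. Zhang 2014 Lemma 3.3 / (4.8);
  Ribet 1990; Diamond–Taylor 1994) — to be vendored as named facts by their users; the row sums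
  `Σ_i (U_ℓ)_ij = ℓ`; `uMatrix = matrix` at `ℓ ∤ N⁺`; independence of the orientation up to
  conjugacy; the identification of `lowerLeft/lowerRight` as Eichler orders of level `N⁺/ℓ`
  (a local index computation). Mathlib/tree searches: no `U`-operator, degeneracy map or
  new quotient for quaternion orders (`lean search 'degenerac|newQuotient|U_p|uMatrix'` in
  `Literature/NumberTheory`); the anemic algebra `Brandt.XiSetup.heckeAlgebra` (primes `∤ N⁺N⁻`)
  exists in `BrandtEigenAugmentation.lean` and is not redefined.

## References

* [WZhang2014] W. Zhang, *Selmer groups and the indivisibility of Heegner points*, Camb. J. Math.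
  2 (2014), §3.1 p. 204, §3.9 p. 214, (4.7)–(4.8) pp. 218–219, §6.1 p. 226.
* [BertoliniDarmon2001] M. Bertolini, H. Darmon, *The p-adic L-functions of modular elliptic
  curves*, in *Mathematics Unlimited — 2001 and Beyond*, Springer (2001), §3.1 p. 127, §4.1
  pp. 142–144.
* [BertoliniDarmon1999] M. Bertolini, H. Darmon, *Euler systems and Jochnowitz congruences*,
  Amer. J. Math. 121 (1999), §2 pp. 265–267.
* [Gross1987] B. H. Gross, *Heights and the special values of L-series* (1987), §§1–4.
* [VignerasLNM800] M.-F. Vignéras, LNM 800 (1980), Ch. II §2 (Thm. 2.3, Lemme 2.4), Ch. III §5.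
* [Voight2021] J. Voight, *Quaternion Algebras*, GTM 288, Main Thm. 16.6.1, 23.4.3, 23.4.12,
  (41.1.1), Def. 41.3.14.
* [Pizer1980] A. Pizer, J. Algebra 64 (1980), §2 (Brandt matrices `B(n)` for all `n`; Prop. 2.22 —
  Hecke only for `(n, N) = 1`).
* [PollackWeston2011] R. Pollack, T. Weston, Compos. Math. 147 (2011), §2.1.
* [Ribet1990] K. Ribet, Invent. Math. 100 (1990), §3.
-/

noncomputable section

open scoped Pointwise Matrix

universe u

namespace Literature.NumberTheory.Automorphic

namespace Brandt

variable {D : Type u} [Ring D]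

/-! ### The link `𝒯 = (O₂ : O₁) ∩ O₁` of an ordered pair of orders -/

/-- The **link** of the ordered pair of orders `(O₁, O₂)`: `𝒯 = {x ∈ O₁ | x O₁ ⊆ O₂}`, a right
`O₁`- and left `(O₁ ∩ O₂)`-submodule of `O₁ ∩ O₂`. For maximal orders at distance `e` at a split
prime `ℓ` (`O₁,ℓ = End L₁`, `O₂,ℓ = End L₂`, `L₁ ⊋ L₂ ⊋ ℓ^e L₁`) its localisation is
`Hom(L₁, L₂)`, the integral ideal linking `O₁` to `O₂` (Voight §17.4 "connecting ideal";
Vignéras III §5, "idéal qui lie"); at primes where `O₁ = O₂` it is the order itself. [cite: Voight2021, Exercise 21.11 (c) p. 342 (colon ideal `(O₁ : O₂)_L`; unfolding)] -/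
def link (O₁ O₂ : Submodule ℤ D) : Submodule ℤ D where
  carrier := {x | x ∈ O₁ ∧ ∀ y ∈ O₁, x * y ∈ O₂}
  add_mem' {a b} ha hb := ⟨O₁.add_mem ha.1 hb.1, fun y hy => by
    rw [add_mul]; exact O₂.add_mem (ha.2 y hy) (hb.2 y hy)⟩
  zero_mem' := ⟨O₁.zero_mem, fun y _ => by rw [zero_mul]; exact O₂.zero_mem⟩
  smul_mem' n {a} ha := ⟨O₁.smul_mem n ha.1, fun y hy => by
    rw [smul_mul_assoc]; exact O₂.smul_mem n (ha.2 y hy)⟩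

/-- `x ∈ link O₁ O₂ ↔ x ∈ O₁ ∧ x O₁ ⊆ O₂` (definitional). [cite: Voight2021, Exercise 21.11 (c) p. 342 (colon ideal `(O₁ : O₂)_L`; unfolding)] -/
theorem mem_link_iff {O₁ O₂ : Submodule ℤ D} {x : D} :
    x ∈ link O₁ O₂ ↔ x ∈ O₁ ∧ ∀ y ∈ O₁, x * y ∈ O₂ := Iff.rfl

/-- `link O₁ O₂ ⊆ O₁`. [cite: Voight2021, Exercise 21.11 (c) p. 342 (colon ideal `(O₁ : O₂)_L`; unfolding)] -/
theorem link_le_left (O₁ O₂ : Submodule ℤ D) : link O₁ O₂ ≤ O₁ := fun _ hx => hx.1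

/-- `link O₁ O₂ ⊆ O₂` as soon as `1 ∈ O₁`. [cite: Voight2021, Exercise 21.11 (c) p. 342 (colon ideal `(O₁ : O₂)_L`; unfolding)] -/
theorem link_le_right {O₁ : Submodule ℤ D} (O₂ : Submodule ℤ D) (h1 : (1 : D) ∈ O₁) :
    link O₁ O₂ ≤ O₂ := fun x hx => by simpa using hx.2 1 h1

/-- `link(O₁, O₂) · O₁ ⊆ O₂` (definitional). [cite: Voight2021, Exercise 21.11 (c) p. 342 (colon ideal `(O₁ : O₂)_L`; unfolding)] -/
theorem link_mul_le (O₁ O₂ : Submodule ℤ D) : link O₁ O₂ * O₁ ≤ O₂ :=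
  Submodule.mul_le.mpr fun _ hx _ hy => hx.2 _ hy

/-- `link(O₁, O₂)` is a right `O₁`-module (`O₁` multiplicatively closed). [cite: Voight2021, Exercise 21.11 (c) p. 342 (colon ideal `(O₁ : O₂)_L`; unfolding)] -/
theorem link_mul_le_link {O₁ : Submodule ℤ D} (O₂ : Submodule ℤ D) (hO₁ : IsOrder D O₁) :
    link O₁ O₂ * O₁ ≤ link O₁ O₂ :=
  Submodule.mul_le.mpr fun x hx y hy =>
    ⟨hO₁.mul_mem x hx.1 y hy, fun z hz => by rw [mul_assoc]; exact hx.2 _ (hO₁.mul_mem y hy z hz)⟩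

/-- `link(O₁, O₂)` is a left `(O₁ ∩ O₂)`-module. [cite: Voight2021, Exercise 21.11 (c) p. 342 (colon ideal `(O₁ : O₂)_L`; unfolding)] -/
theorem inf_mul_link_le {O₁ O₂ : Submodule ℤ D} (hO₁ : IsOrder D O₁) (hO₂ : IsOrder D O₂) :
    (O₁ ⊓ O₂) * link O₁ O₂ ≤ link O₁ O₂ :=
  Submodule.mul_le.mpr fun z hz x hx =>
    ⟨hO₁.mul_mem z hz.1 x hx.1, fun y hy => by
      rw [mul_assoc]; exact hO₂.mul_mem z hz.2 _ (hx.2 y hy)⟩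

/-- `link O O = O` for an order `O`. [cite: Voight2021, Exercise 21.11 (c) p. 342 (colon ideal `(O₁ : O₂)_L`; unfolding)] -/
theorem link_self {O : Submodule ℤ D} (hO : IsOrder D O) : link O O = O :=
  le_antisymm (link_le_left O O) fun x hx => ⟨hx, fun y hy => hO.mul_mem x hx y hy⟩

/-- `link O₁ O₂ = O₁` when `O₁ ⊆ O₂` (`O₁` an order). [cite: Voight2021, Exercise 21.11 (c) p. 342 (colon ideal `(O₁ : O₂)_L`; unfolding)] -/
theorem link_eq_left_of_le {O₁ O₂ : Submodule ℤ D} (hO₁ : IsOrder D O₁) (h : O₁ ≤ O₂) :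
    link O₁ O₂ = O₁ :=
  le_antisymm (link_le_left O₁ O₂) fun x hx => ⟨hx, fun y hy => h (hO₁.mul_mem x hx y hy)⟩

/-- `N ∈ link(O₁, O₂)` whenever `N O₁ ⊆ O₂` (e.g. `N = [O₁ : O₁ ∩ O₂]`): the link is a full
lattice. [cite: Voight2021, Exercise 21.11 (c) p. 342 (colon ideal `(O₁ : O₂)_L`; unfolding)] -/
theorem natCast_mem_link {O₁ O₂ : Submodule ℤ D} (h1 : (1 : D) ∈ O₁) {N : ℕ}
    (hN : ∀ y ∈ O₁, (N : ℤ) • y ∈ O₂) : (N : D) ∈ link O₁ O₂ := by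
  refine ⟨?_, fun y hy => ?_⟩
  · have := O₁.smul_mem (N : ℤ) h1
    rwa [zsmul_eq_mul, mul_one, Int.cast_natCast] at this
  · have := hN y hy
    rwa [zsmul_eq_mul, Int.cast_natCast] at this

/-! ### Translation by units and integer scaling of lattices -/

/-- `β (J T) = (β J) T` for lattices `J, T ⊆ D` and `β ∈ Dˣ`. [cite: Voight2021, Def. 17.3.1 and §41.1 (translation by units; transport)] -/
theorem units_smul_mul (β : Dˣ) (J T : Submodule ℤ D) : β • (J * T) = (β • J) * T := by
  apply le_antisymm
  · intro z hz
    obtain ⟨w, hw, rfl⟩ := (Submodule.mem_smul_pointwise_iff_exists _ _ _).mp hz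
    refine Submodule.mul_induction_on hw (fun x hx y hy => ?_) (fun z w hz hw => ?_)
    · have : β • (x * y) = (β • x) * y := by simp [Units.smul_def, mul_assoc]
      rw [this]
      exact Submodule.mul_mem_mul (Submodule.smul_mem_pointwise_smul x β J hx) hy
    · rw [smul_add]
      exact Submodule.add_mem _ hz hw
  · rw [Submodule.mul_le]
    intro x' hx' y hy
    obtain ⟨x, hx, rfl⟩ := (Submodule.mem_smul_pointwise_iff_exists _ _ _).mp hx'
    have : (β • x) * y = β • (x * y) := by simp [Units.smul_def, mul_assoc]
    rw [this]
    exact Submodule.smul_mem_pointwise_smul _ β _ (Submodule.mul_mem_mul hx hy)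

/-- `β (n v) = n (β v)` for `β ∈ Dˣ`, `n ∈ ℤ`. [cite: Voight2021, Def. 17.3.1 and §41.1 (translation by units; transport)] -/
theorem units_smul_zsmul_comm (β : Dˣ) (n : ℤ) (v : D) : β • (n • v) = n • (β • v) := by
  rw [Units.smul_def, Units.smul_def, smul_eq_mul, smul_eq_mul, mul_smul_comm]

/-- `β (n T) = n (β T)` for a lattice `T`, `β ∈ Dˣ`, `n ∈ ℤ`. [cite: Voight2021, Def. 17.3.1 and §41.1 (translation by units; transport)] -/
theorem units_smul_zsmul (β : Dˣ) (n : ℤ) (T : Submodule ℤ D) : β • (n • T) = n • (β • T) := by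
  apply le_antisymm
  · intro z hz
    obtain ⟨w, hw, rfl⟩ := (Submodule.mem_smul_pointwise_iff_exists _ _ _).mp hz
    obtain ⟨v, hv, rfl⟩ := (Submodule.mem_smul_pointwise_iff_exists _ _ _).mp hw
    rw [units_smul_zsmul_comm]
    exact Submodule.smul_mem_pointwise_smul _ n _ (Submodule.smul_mem_pointwise_smul v β T hv)
  · intro z hz
    obtain ⟨w, hw, rfl⟩ := (Submodule.mem_smul_pointwise_iff_exists _ _ _).mp hz
    obtain ⟨v, hv, rfl⟩ := (Submodule.mem_smul_pointwise_iff_exists _ _ _).mp hw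
    rw [← units_smul_zsmul_comm]
    exact Submodule.smul_mem_pointwise_smul _ β _ (Submodule.smul_mem_pointwise_smul v n T hv)

/-- `n S ⊆ n T` for `S ⊆ T`. [cite: Voight2021, Def. 17.3.1 and §41.1 (translation by units; transport)] -/
theorem zsmul_le_zsmul {S T : Submodule ℤ D} (h : S ≤ T) (n : ℤ) : n • S ≤ n • T := by
  intro x hx
  obtain ⟨y, hy, rfl⟩ := (Submodule.mem_smul_pointwise_iff_exists _ _ _).mp hx
  exact Submodule.smul_mem_pointwise_smul _ _ _ (h hy)

/-! ### Forward sub-ideals at `ℓ` and the matrix of `U_ℓ` -/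

/-- **`J` is a forward (`U_ℓ`-type) sub-lattice of `I` at `ℓ` for the orientation `(O₁, O₂)`**:
`J · link(O₁, O₂) ⊄ ℓ · (I O₁)`. For `O = O₁ ∩ O₂` an Eichler order, `I` an invertible right
`O`-ideal and `J ⊆ I` a sub-ideal of index `ℓ²`, with local lattice pairs `I_ℓ ↔ (M₁, M₂)`,
`J_ℓ ↔ (M₁', M₂')`, this says `M₂' ⊄ ℓ M₁`, i.e. `J_ℓ ∈ I_ℓ · O_ℓˣ diag(1, ℓ) O_ℓˣ`: `J` is one
of the `ℓ` sub-ideals pushing the geodesic `[M₁] → [M₂]` one step forward (module docstring; at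
`ℓ ∤ [O₁ : O]` every sub-ideal of index `ℓ²` satisfies it). The adelic/Bruhat–Tits form is
Bertolini–Darmon's `U_p(e) = {e' : source(e') = target(e)}`. [cite: BertoliniDarmon2001, §3.1 p. 127 and §4.1 pp. 142–144] -/
def IsForward (O₁ O₂ : Submodule ℤ D) (ℓ : ℕ) (J I : Submodule ℤ D) : Prop :=
  ¬ J * link O₁ O₂ ≤ (ℓ : ℤ) • (I * O₁)

/-- Unfolding of `IsForward`. [cite: BertoliniDarmon2001, §4.1 pp. 142–144 (the `U_p`-correspondence; unfolding)] -/
theorem isForward_iff {O₁ O₂ : Submodule ℤ D} {ℓ : ℕ} {J I : Submodule ℤ D} :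
    IsForward O₁ O₂ ℓ J I ↔ ¬ J * link O₁ O₂ ≤ (ℓ : ℤ) • (I * O₁) := Iff.rfl

/-- The forward condition is invariant under simultaneous left translation by a unit. [cite: BertoliniDarmon2001, §4.1 pp. 142–144 (the `U_p`-correspondence; unfolding)] -/
theorem isForward_units_smul_iff (β : Dˣ) {O₁ O₂ : Submodule ℤ D} {ℓ : ℕ}
    {J I : Submodule ℤ D} : IsForward O₁ O₂ ℓ (β • J) (β • I) ↔ IsForward O₁ O₂ ℓ J I := by
  rw [IsForward, IsForward, ← units_smul_mul, ← units_smul_mul, ← units_smul_zsmul,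
    units_smul_le_units_smul_iff]

/-- The **filtered Brandt set**: sub-lattices `J ⊆ I` of index `n²` in the unit orbit of `I'`
satisfying the predicate `P J I` (for `P = ⊤` this is the set counted by `Brandt.matrix`,
`subidealsWith_true`). [cite: Voight2021, (41.1.1) (with a side condition; unfolding)] -/
def subidealsWith (P : Submodule ℤ D → Submodule ℤ D → Prop) (n : ℕ) (I' I : Submodule ℤ D) :
    Set (Submodule ℤ D) :=
  {J | J ≤ I ∧ J.toAddSubgroup.relIndex I.toAddSubgroup = n ^ 2 ∧ P J I ∧ ∃ α : Dˣ, J = α • I'}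

/-- Membership in the filtered Brandt set (definitional). [cite: Voight2021, (41.1.1) (with a side condition; unfolding)] -/
theorem mem_subidealsWith_iff {P : Submodule ℤ D → Submodule ℤ D → Prop} {n : ℕ}
    {I' I J : Submodule ℤ D} : J ∈ subidealsWith P n I' I ↔
      J ≤ I ∧ J.toAddSubgroup.relIndex I.toAddSubgroup = n ^ 2 ∧ P J I ∧ ∃ α : Dˣ, J = α • I' :=
  Iff.rfl

/-- The filtered Brandt set is contained in the Brandt set. [cite: Voight2021, (41.1.1) (with a side condition; unfolding)] -/
theorem subidealsWith_subset (P : Submodule ℤ D → Submodule ℤ D → Prop) (n : ℕ)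
    (I' I : Submodule ℤ D) : subidealsWith P n I' I ⊆
      {J | J ≤ I ∧ J.toAddSubgroup.relIndex I.toAddSubgroup = n ^ 2 ∧ ∃ α : Dˣ, J = α • I'} :=
  fun _ hJ => ⟨hJ.1, hJ.2.1, hJ.2.2.2⟩

/-- With the trivial predicate the filtered Brandt set is the Brandt set. [cite: Voight2021, (41.1.1) (with a side condition; unfolding)] -/
theorem subidealsWith_true (n : ℕ) (I' I : Submodule ℤ D) :
    subidealsWith (fun _ _ => True) n I' I =
      {J | J ≤ I ∧ J.toAddSubgroup.relIndex I.toAddSubgroup = n ^ 2 ∧ ∃ α : Dˣ, J = α • I'} :=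
  Set.ext fun _ => by simp [subidealsWith]

/-- The **filtered Brandt matrix** `T_P(n)_ij = #{J ⊆ I_j : [I_j : J] = n², P J I_j, J ∈ Dˣ I_i}`
(Voight (41.1.1) with a side condition `P`; `P = ⊤` gives `Brandt.matrix`, `matrixWith_true`). [cite: Voight2021, (41.1.1)] -/
def matrixWith (O : Submodule ℤ D) (P : Submodule ℤ D → Submodule ℤ D → Prop) (n : ℕ) :
    Matrix (ClassSet O) (ClassSet O) ℤ :=
  Matrix.of fun i j => ((subidealsWith P n i.rep j.rep).ncard : ℤ)

/-- The entries of the filtered Brandt matrix (definitional). [cite: Voight2021, (41.1.1) (with a side condition; unfolding)] -/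
theorem matrixWith_apply (O : Submodule ℤ D) (P : Submodule ℤ D → Submodule ℤ D → Prop) (n : ℕ)
    (i j : ClassSet O) : matrixWith O P n i j = ((subidealsWith P n i.rep j.rep).ncard : ℤ) := rfl

/-- `matrixWith O ⊤ n = Brandt.matrix O n`. [cite: Voight2021, (41.1.1) (with a side condition; unfolding)] -/
theorem matrixWith_true (O : Submodule ℤ D) (n : ℕ) :
    matrixWith O (fun _ _ => True) n = matrix O n := by
  ext i j
  rw [matrixWith_apply, subidealsWith_true, matrix, Matrix.of_apply]

/-- The entries of a filtered Brandt matrix are non-negative. [cite: Voight2021, (41.1.1) (with a side condition; unfolding)] -/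
theorem matrixWith_nonneg (O : Submodule ℤ D) (P : Submodule ℤ D → Submodule ℤ D → Prop) (n : ℕ)
    (i j : ClassSet O) : 0 ≤ matrixWith O P n i j := by
  rw [matrixWith_apply]; exact Int.natCast_nonneg _

/-- The filtered Brandt set on representatives is finite (`n ≠ 0`). [cite: Voight2021, (41.1.1) (with a side condition; unfolding)] -/
theorem finite_subidealsWith [IsAddTorsionFree D] {O : Submodule ℤ D}
    (P : Submodule ℤ D → Submodule ℤ D → Prop) (i j : ClassSet O) {n : ℕ} (hn : n ≠ 0) :
    (subidealsWith P n i.rep j.rep).Finite :=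
  (finite_brandtSet i j hn).subset (subidealsWith_subset P n _ _)

/-- A filtered Brandt matrix is entrywise bounded by the Brandt matrix (`n ≠ 0`). [cite: Voight2021, (41.1.1) (with a side condition; unfolding)] -/
theorem matrixWith_le_matrix [IsAddTorsionFree D] (O : Submodule ℤ D)
    (P : Submodule ℤ D → Submodule ℤ D → Prop) {n : ℕ} (hn : n ≠ 0) (i j : ClassSet O) :
    matrixWith O P n i j ≤ matrix O n i j := by
  rw [matrixWith_apply, matrix, Matrix.of_apply]
  exact_mod_cast Set.ncard_le_ncard (subidealsWith_subset P n _ _) (finite_brandtSet i j hn)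

/-- A predicate `P J I` on pairs of lattices is **translation invariant** if
`P (β J) (β I) ↔ P J I` for all units `β`. [cite: Voight2021, (41.1.1) (with a side condition; unfolding)] -/
def IsTranslationInvariant (P : Submodule ℤ D → Submodule ℤ D → Prop) : Prop :=
  ∀ (β : Dˣ) (J I : Submodule ℤ D), P (β • J) (β • I) ↔ P J I

/-- The forward condition is translation invariant. [cite: BertoliniDarmon2001, §4.1 pp. 142–144 (the `U_p`-correspondence; unfolding)] -/
theorem isTranslationInvariant_isForward (O₁ O₂ : Submodule ℤ D) (ℓ : ℕ) :
    IsTranslationInvariant (IsForward O₁ O₂ ℓ) := fun β _ _ => isForward_units_smul_iff β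

/-- Changing the ambient representative `I ↦ β I` replaces the filtered Brandt set by its image
under `J ↦ β J` (translation-invariant `P`). [cite: Voight2021, (41.1.1) (with a side condition; unfolding)] -/
theorem subidealsWith_smul_right {P : Submodule ℤ D → Submodule ℤ D → Prop}
    (hP : IsTranslationInvariant P) (β : Dˣ) (n : ℕ) (I' I : Submodule ℤ D) :
    subidealsWith P n I' (β • I) = (fun J : Submodule ℤ D => β • J) '' subidealsWith P n I' I := by
  ext J
  simp only [subidealsWith, Set.mem_setOf_eq, Set.mem_image]
  constructor
  · rintro ⟨hle, hidx, hPJ, α, hα⟩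
    refine ⟨β⁻¹ • J, ⟨?_, ?_, ?_, β⁻¹ * α, by rw [hα, mul_smul]⟩, smul_inv_smul β J⟩
    · rwa [← units_smul_le_units_smul_iff β, smul_inv_smul]
    · rw [← relIndex_units_smul β, smul_inv_smul]; exact hidx
    · rw [← hP β, smul_inv_smul]; exact hPJ
  · rintro ⟨J₀, ⟨hle, hidx, hPJ, α, hα⟩, rfl⟩
    refine ⟨(units_smul_le_units_smul_iff β).mpr hle, ?_, (hP β _ _).mpr hPJ, β * α,
      by rw [hα, mul_smul]⟩
    rw [relIndex_units_smul]; exact hidx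

/-- Changing the class representative `I' ↦ γ I'` does not change the filtered Brandt set. [cite: Voight2021, (41.1.1) (with a side condition; unfolding)] -/
theorem subidealsWith_smul_left (P : Submodule ℤ D → Submodule ℤ D → Prop) (γ : Dˣ) (n : ℕ)
    (I' I : Submodule ℤ D) : subidealsWith P n (γ • I') I = subidealsWith P n I' I := by
  ext J
  simp only [subidealsWith, Set.mem_setOf_eq]
  refine and_congr_right fun _ => and_congr_right fun _ => and_congr_right fun _ => ⟨?_, ?_⟩
  · rintro ⟨α, hα⟩; exact ⟨α * γ, by rw [hα, mul_smul]⟩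
  · rintro ⟨α, hα⟩; exact ⟨α * γ⁻¹, by rw [hα, mul_smul, inv_smul_smul]⟩

/-- The size of the filtered Brandt set is unchanged under `I ↦ β I`, `I' ↦ γ I'`. [cite: Voight2021, (41.1.1) (with a side condition; unfolding)] -/
theorem ncard_subidealsWith_smul {P : Submodule ℤ D → Submodule ℤ D → Prop}
    (hP : IsTranslationInvariant P) (β γ : Dˣ) (n : ℕ) (I' I : Submodule ℤ D) :
    (subidealsWith P n (γ • I') (β • I)).ncard = (subidealsWith P n I' I).ncard := by
  rw [subidealsWith_smul_left, subidealsWith_smul_right hP]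
  exact Set.ncard_image_of_injective _ (MulAction.injective β)

/-- **A filtered Brandt matrix may be computed on any representatives** (translation-invariant
`P`): for right ideals `I'` of class `i` and `I` of class `j`,
`T_P(n)_ij = #{J ⊆ I : [I : J] = n², P J I, J = α I'}`. [cite: Voight2021, (41.1.1) (with a side condition; unfolding)] -/
theorem matrixWith_apply_eq_ncard {O : Submodule ℤ D} {P : Submodule ℤ D → Submodule ℤ D → Prop}
    (hP : IsTranslationInvariant P) (n : ℕ) (I' I : rightIdeals O) :
    matrixWith O P n (Quotient.mk (rightClassSetoid O) I') (Quotient.mk (rightClassSetoid O) I) =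
      ((subidealsWith P n (I' : Submodule ℤ D) (I : Submodule ℤ D)).ncard : ℤ) := by
  obtain ⟨β, hβ⟩ := exists_rep_mk_eq_smul I
  obtain ⟨γ, hγ⟩ := exists_rep_mk_eq_smul I'
  rw [matrixWith_apply, hβ, hγ, ncard_subidealsWith_smul hP]

/-- **The matrix of `U_ℓ` on `ℤ[Cls O]` for the orientation `(O₁, O₂)`** (`O = O₁ ∩ O₂` an Eichler
order, `ℓ` a prime dividing its level): `(U_ℓ)_ij = #{J ⊆ I_j : [I_j : J] = ℓ², J forward at ℓ,
J ∈ Dˣ I_i}`, the correspondence `[I] ↦ Σ [J]` over the `ℓ` forward sub-ideals of `I`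
(= the double coset `R̂ˣ diag(1, ℓ)_ℓ R̂ˣ` on `Bˣ \ B̂ˣ / R̂ˣ = Cls O`; W. Zhang 2014 §3.9: "`U_ℓ`
for `ℓ ∣ N` acting on `ℤ[X]`"; Bertolini–Darmon 2001 §4.1). Same index convention as
`Brandt.matrix` (acts on divisor vectors by `mulVec`, on functions by `vecMul`). [cite: WZhang2014, §3.9 p. 214 and §6.1 p. 226] -/
def uMatrix (O O₁ O₂ : Submodule ℤ D) (ℓ : ℕ) : Matrix (ClassSet O) (ClassSet O) ℤ :=
  matrixWith O (IsForward O₁ O₂ ℓ) ℓ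

/-- The entries of `U_ℓ` (definitional). [cite: WZhang2014, §3.9 p. 214 (`U_ℓ` on `ℤ[X]`; unfolding)] -/
theorem uMatrix_apply (O O₁ O₂ : Submodule ℤ D) (ℓ : ℕ) (i j : ClassSet O) :
    uMatrix O O₁ O₂ ℓ i j = ((subidealsWith (IsForward O₁ O₂ ℓ) ℓ i.rep j.rep).ncard : ℤ) := rfl

/-- `uMatrix` is the filtered Brandt matrix for the forward filter (definitional). [cite: WZhang2014, §3.9 p. 214 (`U_ℓ` on `ℤ[X]`; unfolding)] -/
theorem uMatrix_eq_matrixWith (O O₁ O₂ : Submodule ℤ D) (ℓ : ℕ) :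
    uMatrix O O₁ O₂ ℓ = matrixWith O (IsForward O₁ O₂ ℓ) ℓ := rfl

/-- The entries of `U_ℓ` are non-negative. [cite: WZhang2014, §3.9 p. 214 (`U_ℓ` on `ℤ[X]`; unfolding)] -/
theorem uMatrix_nonneg (O O₁ O₂ : Submodule ℤ D) (ℓ : ℕ) (i j : ClassSet O) :
    0 ≤ uMatrix O O₁ O₂ ℓ i j := matrixWith_nonneg _ _ _ _ _

/-- **`U_ℓ ≤ T(ℓ)` entrywise** (the forward sub-ideals are among all sub-ideals of index `ℓ²`). [cite: WZhang2014, §3.9 p. 214 (`U_ℓ` on `ℤ[X]`; unfolding)] -/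
theorem uMatrix_le_matrix [IsAddTorsionFree D] (O O₁ O₂ : Submodule ℤ D) {ℓ : ℕ} (hℓ : ℓ ≠ 0)
    (i j : ClassSet O) : uMatrix O O₁ O₂ ℓ i j ≤ matrix O ℓ i j :=
  matrixWith_le_matrix O _ hℓ i j

/-- `U_ℓ` may be computed on any representatives. [cite: WZhang2014, §3.9 p. 214 (`U_ℓ` on `ℤ[X]`; unfolding)] -/
theorem uMatrix_apply_eq_ncard {O : Submodule ℤ D} (O₁ O₂ : Submodule ℤ D) (ℓ : ℕ)
    (I' I : rightIdeals O) :
    uMatrix O O₁ O₂ ℓ (Quotient.mk (rightClassSetoid O) I') (Quotient.mk (rightClassSetoid O) I) =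
      ((subidealsWith (IsForward O₁ O₂ ℓ) ℓ (I' : Submodule ℤ D) (I : Submodule ℤ D)).ncard : ℤ) :=
  matrixWith_apply_eq_ncard (isTranslationInvariant_isForward O₁ O₂ ℓ) ℓ I' I

/-! ### Retracting an end at `ℓ`: the two Eichler orders of level `N⁺/ℓ` above `O₁ ∩ O₂` -/

/-- `ℓ⁻¹ T ∩ D = {x | ℓ x ∈ T}` as a `ℤ`-submodule. [cite: VignerasLNM800, Ch. II §2 (ordres d'Eichler de niveau `p^n`, Lemme 2.4; unfolding)] -/
def divMul (ℓ : ℕ) (T : Submodule ℤ D) : Submodule ℤ D := T.comap (DistribSMul.toLinearMap ℤ D (ℓ : ℤ))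

/-- `x ∈ divMul ℓ T ↔ ℓ x ∈ T` (definitional). [cite: VignerasLNM800, Ch. II §2 (ordres d'Eichler de niveau `p^n`, Lemme 2.4; unfolding)] -/
theorem mem_divMul_iff {ℓ : ℕ} {T : Submodule ℤ D} {x : D} : x ∈ divMul ℓ T ↔ (ℓ : ℤ) • x ∈ T :=
  Iff.rfl

/-- `T ⊆ ℓ⁻¹ T`. [cite: VignerasLNM800, Ch. II §2 (ordres d'Eichler de niveau `p^n`, Lemme 2.4; unfolding)] -/
theorem le_divMul (ℓ : ℕ) (T : Submodule ℤ D) : T ≤ divMul ℓ T := fun _ hx => T.smul_mem _ hx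

/-- **Retraction of `O₂` one step towards `O₁` at `ℓ`**: the left order of the lattice
`O₁ ∩ ℓ⁻¹ link(O₁, O₂)`. Locally at `ℓ` (`O₁ = End L₁`, `O₂ = End L₂`, `L₁ ⊋ L₂ ⊋ ℓ^e L₁`,
`e ≥ 1`) that lattice is `Hom(L₁, L₂ + ℓ^{e-1} L₁)`, with left order `End(L₂ + ℓ^{e-1} L₁)`, the
vertex of the geodesic `[L₁] → [L₂]` adjacent to `[L₂]`; at other primes it is `link(O₁, O₂)`,
with left order `O₂`. [cite: VignerasLNM800, Ch. II §2 (ordres d'Eichler de niveau `p^n`, Lemme 2.4; unfolding)] -/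
def retract (O₁ O₂ : Submodule ℤ D) (ℓ : ℕ) : Submodule ℤ D :=
  leftOrder (O₁ ⊓ divMul ℓ (link O₁ O₂))

/-- Unfolding of `retract`. [cite: VignerasLNM800, Ch. II §2 (ordres d'Eichler de niveau `p^n`, Lemme 2.4; unfolding)] -/
theorem retract_def (O₁ O₂ : Submodule ℤ D) (ℓ : ℕ) :
    retract O₁ O₂ ℓ = leftOrder (O₁ ⊓ divMul ℓ (link O₁ O₂)) := rfl

/-- `1 ∈ retract O₁ O₂ ℓ`. [cite: VignerasLNM800, Ch. II §2 (ordres d'Eichler de niveau `p^n`, Lemme 2.4; unfolding)] -/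
theorem one_mem_retract (O₁ O₂ : Submodule ℤ D) (ℓ : ℕ) : (1 : D) ∈ retract O₁ O₂ ℓ :=
  one_mem_leftOrder _

/-- `retract O₁ O₂ ℓ` is multiplicatively closed. [cite: VignerasLNM800, Ch. II §2 (ordres d'Eichler de niveau `p^n`, Lemme 2.4; unfolding)] -/
theorem mul_mem_retract {O₁ O₂ : Submodule ℤ D} {ℓ : ℕ} {a b : D} (ha : a ∈ retract O₁ O₂ ℓ)
    (hb : b ∈ retract O₁ O₂ ℓ) : a * b ∈ retract O₁ O₂ ℓ :=
  mul_mem_leftOrder ha hb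

/-- `O₁ ∩ O₂ ⊆ retract O₁ O₂ ℓ`. [cite: VignerasLNM800, Ch. II §2 (ordres d'Eichler de niveau `p^n`, Lemme 2.4; unfolding)] -/
theorem inf_le_retract {O₁ O₂ : Submodule ℤ D} (hO₁ : IsOrder D O₁) (hO₂ : IsOrder D O₂) (ℓ : ℕ) :
    O₁ ⊓ O₂ ≤ retract O₁ O₂ ℓ := by
  intro z hz y hy
  refine ⟨hO₁.mul_mem z hz.1 y hy.1, ?_⟩
  show z * y ∈ divMul ℓ (link O₁ O₂)
  rw [mem_divMul_iff, ← mul_smul_comm]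
  exact inf_mul_link_le hO₁ hO₂ (Submodule.mul_mem_mul hz hy.2)

/-- **`O₁ ∩ O₂` with its `O₂`-end retracted at `ℓ`**: `O₁ ∩ retract(O₁, O₂, ℓ)` — for an
Eichler order `O₁ ∩ O₂` of level `N⁺` with `ℓ ∣ N⁺`, one of the two Eichler orders of level
`N⁺/ℓ` containing it. [cite: VignerasLNM800, Ch. II §2 (ordres d'Eichler de niveau `p^n`, Lemme 2.4; unfolding)] -/
def lowerRight (O₁ O₂ : Submodule ℤ D) (ℓ : ℕ) : Submodule ℤ D := O₁ ⊓ retract O₁ O₂ ℓ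

/-- **`O₁ ∩ O₂` with its `O₁`-end retracted at `ℓ`**: `retract(O₂, O₁, ℓ) ∩ O₂`, the other Eichler
order of level `N⁺/ℓ` containing `O₁ ∩ O₂`. [cite: VignerasLNM800, Ch. II §2 (ordres d'Eichler de niveau `p^n`, Lemme 2.4; unfolding)] -/
def lowerLeft (O₁ O₂ : Submodule ℤ D) (ℓ : ℕ) : Submodule ℤ D := retract O₂ O₁ ℓ ⊓ O₂

/-- `O₁ ∩ O₂ ⊆ lowerRight O₁ O₂ ℓ`. [cite: VignerasLNM800, Ch. II §2 (ordres d'Eichler de niveau `p^n`, Lemme 2.4; unfolding)] -/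
theorem inf_le_lowerRight {O₁ O₂ : Submodule ℤ D} (hO₁ : IsOrder D O₁) (hO₂ : IsOrder D O₂)
    (ℓ : ℕ) : O₁ ⊓ O₂ ≤ lowerRight O₁ O₂ ℓ :=
  le_inf inf_le_left (inf_le_retract hO₁ hO₂ ℓ)

/-- `O₁ ∩ O₂ ⊆ lowerLeft O₁ O₂ ℓ`. [cite: VignerasLNM800, Ch. II §2 (ordres d'Eichler de niveau `p^n`, Lemme 2.4; unfolding)] -/
theorem inf_le_lowerLeft {O₁ O₂ : Submodule ℤ D} (hO₁ : IsOrder D O₁) (hO₂ : IsOrder D O₂)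
    (ℓ : ℕ) : O₁ ⊓ O₂ ≤ lowerLeft O₁ O₂ ℓ :=
  le_inf (inf_comm O₁ O₂ ▸ inf_le_retract hO₂ hO₁ ℓ) inf_le_right

/-- `1 ∈ lowerRight O₁ O₂ ℓ`. [cite: VignerasLNM800, Ch. II §2 (ordres d'Eichler de niveau `p^n`, Lemme 2.4; unfolding)] -/
theorem one_mem_lowerRight {O₁ O₂ : Submodule ℤ D} (h1 : (1 : D) ∈ O₁) (ℓ : ℕ) :
    (1 : D) ∈ lowerRight O₁ O₂ ℓ := ⟨h1, one_mem_retract O₁ O₂ ℓ⟩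

/-- `lowerRight O₁ O₂ ℓ` is multiplicatively closed. [cite: VignerasLNM800, Ch. II §2 (ordres d'Eichler de niveau `p^n`, Lemme 2.4; unfolding)] -/
theorem mul_mem_lowerRight {O₁ O₂ : Submodule ℤ D} (hO₁ : IsOrder D O₁) {ℓ : ℕ} {a b : D}
    (ha : a ∈ lowerRight O₁ O₂ ℓ) (hb : b ∈ lowerRight O₁ O₂ ℓ) : a * b ∈ lowerRight O₁ O₂ ℓ :=
  ⟨hO₁.mul_mem a ha.1 b hb.1, mul_mem_retract ha.2 hb.2⟩

/-- **The retraction is an order** (Voight Lemma 10.2.7: the left order of a full lattice), as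
soon as `n O₁ ⊆ O₂` for some integer `n ≠ 0` (so that `O₁ ∩ ℓ⁻¹ link(O₁, O₂) ⊇ n O₁` is full). [cite: Voight2021, Lemma 10.2.7] -/
theorem isOrder_retract [IsAddTorsionFree D] {O₁ O₂ : Submodule ℤ D} (hO₁ : IsOrder D O₁)
    {n : ℤ} (hn : n ≠ 0) (hnO : ∀ y ∈ O₁, n • y ∈ O₂) (ℓ : ℕ) :
    IsOrder D (retract O₁ O₂ ℓ) := by
  refine isOrder_leftOrder ⟨?_, fun d => ?_⟩
  · haveI : IsNoetherian ℤ O₁ := by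
      haveI : Module.Finite ℤ O₁ := Module.Finite.iff_fg.mpr hO₁.isFullLattice.1
      infer_instance
    have hfg : ((O₁ ⊓ divMul ℓ (link O₁ O₂)).comap O₁.subtype).FG := IsNoetherian.noetherian _
    have : O₁ ⊓ divMul ℓ (link O₁ O₂) = ((O₁ ⊓ divMul ℓ (link O₁ O₂)).comap O₁.subtype).map O₁.subtype := by
      rw [Submodule.map_comap_subtype, inf_eq_right.mpr inf_le_left]
    rw [this]
    exact hfg.map _
  · obtain ⟨m, hm, hmd⟩ := hO₁.isFullLattice.2 d
    refine ⟨n * m, mul_ne_zero hn hm, ?_, ?_⟩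
    · rw [mul_smul]; exact O₁.smul_mem _ hmd
    · show (n * m) • d ∈ divMul ℓ (link O₁ O₂)
      rw [mem_divMul_iff, mul_smul]
      refine Submodule.smul_mem _ _ ⟨O₁.smul_mem _ hmd, fun y hy => ?_⟩
      rw [smul_mul_assoc]
      exact hnO _ (hO₁.mul_mem _ hmd y hy)

/-- The retraction of an order towards an order is an order. [cite: Voight2021, Lemma 10.2.7] -/
theorem isOrder_retract_of_isOrder [IsAddTorsionFree D] {O₁ O₂ : Submodule ℤ D}
    (hO₁ : IsOrder D O₁) (hO₂ : IsOrder D O₂) (ℓ : ℕ) : IsOrder D (retract O₁ O₂ ℓ) := by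
  obtain ⟨n, hn, hnO⟩ := exists_smul_mem_of_fg hO₂.isFullLattice hO₁.isFullLattice.1
  exact isOrder_retract hO₁ hn hnO ℓ

/-- `lowerRight O₁ O₂ ℓ` is an order (for orders `O₁, O₂`). [cite: VignerasLNM800, Ch. II §2 (ordres d'Eichler de niveau `p^n`, Lemme 2.4; unfolding)] -/
theorem isOrder_lowerRight [IsAddTorsionFree D] {O₁ O₂ : Submodule ℤ D} (hO₁ : IsOrder D O₁)
    (hO₂ : IsOrder D O₂) (ℓ : ℕ) : IsOrder D (lowerRight O₁ O₂ ℓ) :=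
  hO₁.inf (isOrder_retract_of_isOrder hO₁ hO₂ ℓ)

/-- `lowerLeft O₁ O₂ ℓ` is an order (for orders `O₁, O₂`). [cite: VignerasLNM800, Ch. II §2 (ordres d'Eichler de niveau `p^n`, Lemme 2.4; unfolding)] -/
theorem isOrder_lowerLeft [IsAddTorsionFree D] {O₁ O₂ : Submodule ℤ D} (hO₁ : IsOrder D O₁)
    (hO₂ : IsOrder D O₂) (ℓ : ℕ) : IsOrder D (lowerLeft O₁ O₂ ℓ) :=
  (isOrder_retract_of_isOrder hO₂ hO₁ ℓ).inf hO₂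

/-! ### Degeneracy matrices, the old submodule and the `N⁺`-new quotient -/

/-- The lattices `I` in the unit orbit of `I'` with `I P = J`: for right ideals, the right
`O`-ideals of the class of `I'` under the right `P`-ideal `J` (`P ⊇ O` an over-order). [cite: BertoliniDarmon1999, §2 p. 265 (the two degeneracy maps, covariant/contravariant; quaternionic form, unfolding)] -/
def underSet (P I' J : Submodule ℤ D) : Set (Submodule ℤ D) := {I | I * P = J ∧ ∃ α : Dˣ, I = α • I'}

/-- Membership in `underSet` (definitional). [cite: BertoliniDarmon1999, §2 p. 265 (the two degeneracy maps, covariant/contravariant; quaternionic form, unfolding)] -/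
theorem mem_underSet_iff {P I' J I : Submodule ℤ D} :
    I ∈ underSet P I' J ↔ I * P = J ∧ ∃ α : Dˣ, I = α • I' := Iff.rfl

/-- **The degeneracy pull-back matrix** of an over-order `P ⊇ O`:
`D^*(P)_{i i'} = #{I right O-ideal of class i : I P = I'_{i'}}`, the transpose correspondence
`[I'] ↦ Σ_{I P = I'} [I]` of the degeneracy map `Cls O → Cls P`, `[I] ↦ [I P]` (for `P` one of
the two Eichler orders of level `N⁺/ℓ` above `O`: one of the two degeneracy maps from level
`N⁺N⁻/ℓ`; `Set.ncard`, so `0` on an infinite set). [cite: BertoliniDarmon1999, §2 p. 265 (the two degeneracy maps, covariant/contravariant; quaternionic form, unfolding)] -/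
def degeneracyPull (O P : Submodule ℤ D) : Matrix (ClassSet O) (ClassSet P) ℤ :=
  Matrix.of fun i i' => ((underSet P i.rep i'.rep).ncard : ℤ)

/-- The entries of the pull-back matrix (definitional). [cite: BertoliniDarmon1999, §2 p. 265 (the two degeneracy maps, covariant/contravariant; quaternionic form, unfolding)] -/
theorem degeneracyPull_apply (O P : Submodule ℤ D) (i : ClassSet O) (i' : ClassSet P) :
    degeneracyPull O P i i' = ((underSet P i.rep i'.rep).ncard : ℤ) := rfl

/-- The entries of the pull-back matrix are non-negative. [cite: BertoliniDarmon1999, §2 p. 265 (the two degeneracy maps, covariant/contravariant; quaternionic form, unfolding)] -/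
theorem degeneracyPull_nonneg (O P : Submodule ℤ D) (i : ClassSet O) (i' : ClassSet P) :
    0 ≤ degeneracyPull O P i i' := by
  rw [degeneracyPull_apply]; exact Int.natCast_nonneg _

open scoped Classical in
/-- **The degeneracy push-forward matrix** of an over-order `P ⊇ O`: the indicator of
`[I_i P] = i'`, i.e. of the map `Cls O → Cls P`, `[I] ↦ [I P]`. [cite: BertoliniDarmon1999, §2 p. 265 (the two degeneracy maps, covariant/contravariant; quaternionic form, unfolding)] -/
def degeneracyPush (O P : Submodule ℤ D) : Matrix (ClassSet P) (ClassSet O) ℤ :=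
  Matrix.of fun i' i => if ∃ α : Dˣ, i.rep * P = α • i'.rep then 1 else 0

open scoped Classical in
/-- The entries of the push-forward matrix (definitional). [cite: BertoliniDarmon1999, §2 p. 265 (the two degeneracy maps, covariant/contravariant; quaternionic form, unfolding)] -/
theorem degeneracyPush_apply (O P : Submodule ℤ D) (i' : ClassSet P) (i : ClassSet O) :
    degeneracyPush O P i' i = if ∃ α : Dˣ, i.rep * P = α • i'.rep then 1 else 0 := rfl

/-- The push-forward matrix has entries in `{0, 1}`. [cite: BertoliniDarmon1999, §2 p. 265 (the two degeneracy maps, covariant/contravariant; quaternionic form, unfolding)] -/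
theorem degeneracyPush_apply_mem (O P : Submodule ℤ D) (i' : ClassSet P) (i : ClassSet O) :
    degeneracyPush O P i' i = 0 ∨ degeneracyPush O P i' i = 1 := by
  rw [degeneracyPush_apply]
  split_ifs
  · exact Or.inr rfl
  · exact Or.inl rfl

/-- **The `P`-old part of `ℤ^{Cls O}`**: the span of the columns `D^*(P) e_{i'}` of the pull-back
matrix, i.e. the image of `ℤ^{Cls P}` under the degeneracy correspondence. [cite: BertoliniDarmon1999, §2 p. 265 (the two degeneracy maps, covariant/contravariant; quaternionic form, unfolding)] -/
def oldPart (O P : Submodule ℤ D) : Submodule ℤ (ClassSet O → ℤ) :=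
  Submodule.span ℤ (Set.range fun i' : ClassSet P => (degeneracyPull O P)ᵀ i')

/-- The columns of the pull-back matrix lie in the old part. [cite: BertoliniDarmon1999, §2 p. 265 (the two degeneracy maps, covariant/contravariant; quaternionic form, unfolding)] -/
theorem transpose_degeneracyPull_mem_oldPart (O P : Submodule ℤ D) (i' : ClassSet P) :
    (degeneracyPull O P)ᵀ i' ∈ oldPart O P :=
  Submodule.subset_span ⟨i', rfl⟩

/-- **The `N⁺`-old submodule of `ℤ^{Cls O}`** for the orientation `(O₁, O₂)`: the sum over the
primes `ℓ ∣ N⁺` of the old parts coming from the two Eichler orders of level `N⁺/ℓ` above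
`O₁ ∩ O₂` (`lowerLeft`, `lowerRight`). [cite: BertoliniDarmon1999, §2 p. 265 (the two degeneracy maps, covariant/contravariant; quaternionic form, unfolding)] -/
def oldSubmodule (O O₁ O₂ : Submodule ℤ D) (Nplus : ℕ) : Submodule ℤ (ClassSet O → ℤ) :=
  ⨆ ℓ ∈ Nplus.primeFactors, (oldPart O (lowerLeft O₁ O₂ ℓ) ⊔ oldPart O (lowerRight O₁ O₂ ℓ))

/-- The old part from `lowerLeft O₁ O₂ ℓ`, `ℓ ∣ N⁺` prime, lies in the old submodule. [cite: BertoliniDarmon1999, §2 p. 265 (the two degeneracy maps, covariant/contravariant; quaternionic form, unfolding)] -/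
theorem oldPart_lowerLeft_le_oldSubmodule (O O₁ O₂ : Submodule ℤ D) {Nplus ℓ : ℕ}
    (hℓ : ℓ ∈ Nplus.primeFactors) : oldPart O (lowerLeft O₁ O₂ ℓ) ≤ oldSubmodule O O₁ O₂ Nplus :=
  le_sup_left.trans (le_iSup₂ (f := fun ℓ _ => oldPart O (lowerLeft O₁ O₂ ℓ) ⊔
    oldPart O (lowerRight O₁ O₂ ℓ)) ℓ hℓ)

/-- The old part from `lowerRight O₁ O₂ ℓ`, `ℓ ∣ N⁺` prime, lies in the old submodule. [cite: BertoliniDarmon1999, §2 p. 265 (the two degeneracy maps, covariant/contravariant; quaternionic form, unfolding)] -/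
theorem oldPart_lowerRight_le_oldSubmodule (O O₁ O₂ : Submodule ℤ D) {Nplus ℓ : ℕ}
    (hℓ : ℓ ∈ Nplus.primeFactors) : oldPart O (lowerRight O₁ O₂ ℓ) ≤ oldSubmodule O O₁ O₂ Nplus :=
  le_sup_right.trans (le_iSup₂ (f := fun ℓ _ => oldPart O (lowerLeft O₁ O₂ ℓ) ⊔
    oldPart O (lowerRight O₁ O₂ ℓ)) ℓ hℓ)

/-- **The `N⁺`-new quotient of the Brandt module `ℤ[Cls O]`**: `ℤ^{Cls O}` modulo the `N⁺`-old
submodule (the quotient by the images of the degeneracy maps from the Eichler orders of level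
`N⁺/ℓ`, `ℓ ∣ N⁺`). [cite: BertoliniDarmon1999, §2 p. 265 (the two degeneracy maps, covariant/contravariant; quaternionic form, unfolding)] -/
def NewQuotient (O O₁ O₂ : Submodule ℤ D) (Nplus : ℕ) : Type u :=
  (ClassSet O → ℤ) ⧸ oldSubmodule O O₁ O₂ Nplus

/-- **The `N⁺`-new submodule of `ℤ^{Cls O}`**: the vectors killed by all degeneracy
push-forwards `ℤ^{Cls O} → ℤ^{Cls P}`, `P` running over the Eichler orders of level `N⁺/ℓ` above
`O₁ ∩ O₂`, `ℓ ∣ N⁺` prime. [cite: BertoliniDarmon1999, §2 p. 265 (the two degeneracy maps, covariant/contravariant; quaternionic form, unfolding)] -/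
def newSubmodule (O O₁ O₂ : Submodule ℤ D) (Nplus : ℕ) [Fintype (ClassSet O)] :
    Submodule ℤ (ClassSet O → ℤ) :=
  ⨅ ℓ ∈ Nplus.primeFactors,
    (LinearMap.ker (degeneracyPush O (lowerLeft O₁ O₂ ℓ)).mulVecLin ⊓
      LinearMap.ker (degeneracyPush O (lowerRight O₁ O₂ ℓ)).mulVecLin)

/-- Membership in the new submodule: all push-forwards vanish. [cite: BertoliniDarmon1999, §2 p. 265 (the two degeneracy maps, covariant/contravariant; quaternionic form, unfolding)] -/
theorem mem_newSubmodule_iff (O O₁ O₂ : Submodule ℤ D) (Nplus : ℕ) [Fintype (ClassSet O)]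
    (v : ClassSet O → ℤ) : v ∈ newSubmodule O O₁ O₂ Nplus ↔ ∀ ℓ ∈ Nplus.primeFactors,
      degeneracyPush O (lowerLeft O₁ O₂ ℓ) *ᵥ v = 0 ∧ degeneracyPush O (lowerRight O₁ O₂ ℓ) *ᵥ v = 0 := by
  simp only [newSubmodule, Submodule.mem_iInf, Submodule.mem_inf, LinearMap.mem_ker,
    Matrix.mulVecLin_apply]

/-! #### Prime by prime: the `ℓ`-old submodule and the `ℓ`-new quotient -/

/-- **The `ℓ`-old submodule of `ℤ^{Cls O}`** for the orientation `(O₁, O₂)` at ONE prime `ℓ`: the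
sum of the old parts coming from the two Eichler orders of level `N⁺/ℓ` above `O₁ ∩ O₂`
(`lowerLeft`, `lowerRight`); `oldSubmodule` is the supremum of these over `ℓ ∣ N⁺`
(`oldSubmodule_eq_iSup_oldSubmoduleAt`). [cite: BertoliniDarmon1999, §2 p. 265 (the two degeneracy maps, covariant/contravariant; quaternionic form, unfolding)] -/
def oldSubmoduleAt (O O₁ O₂ : Submodule ℤ D) (ℓ : ℕ) : Submodule ℤ (ClassSet O → ℤ) :=
  oldPart O (lowerLeft O₁ O₂ ℓ) ⊔ oldPart O (lowerRight O₁ O₂ ℓ)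

/-- `oldSubmodule` is the supremum over the prime factors of `N⁺` of the `ℓ`-old submodules
(definitional). [cite: BertoliniDarmon1999, §2 p. 265 (the two degeneracy maps, covariant/contravariant; quaternionic form, unfolding)] -/
theorem oldSubmodule_eq_iSup_oldSubmoduleAt (O O₁ O₂ : Submodule ℤ D) (Nplus : ℕ) :
    oldSubmodule O O₁ O₂ Nplus = ⨆ ℓ ∈ Nplus.primeFactors, oldSubmoduleAt O O₁ O₂ ℓ := rfl

/-- The `ℓ`-old submodule, `ℓ ∣ N⁺` prime, lies in the `N⁺`-old submodule. [cite: BertoliniDarmon1999, §2 p. 265 (the two degeneracy maps, covariant/contravariant; quaternionic form, unfolding)] -/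
theorem oldSubmoduleAt_le_oldSubmodule (O O₁ O₂ : Submodule ℤ D) {Nplus ℓ : ℕ}
    (hℓ : ℓ ∈ Nplus.primeFactors) : oldSubmoduleAt O O₁ O₂ ℓ ≤ oldSubmodule O O₁ O₂ Nplus :=
  le_iSup₂ (f := fun ℓ _ => oldSubmoduleAt O O₁ O₂ ℓ) ℓ hℓ

/-- **The `ℓ`-new quotient of the Brandt module `ℤ[Cls O]`** at one prime `ℓ`: `ℤ^{Cls O}` modulo
the `ℓ`-old submodule. [cite: BertoliniDarmon1999, §2 p. 265 (the two degeneracy maps, covariant/contravariant; quaternionic form, unfolding)] -/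
def NewQuotientAt (O O₁ O₂ : Submodule ℤ D) (ℓ : ℕ) : Type u :=
  (ClassSet O → ℤ) ⧸ oldSubmoduleAt O O₁ O₂ ℓ

/-- **The `ℓ`-new submodule of `ℤ^{Cls O}`** at one prime `ℓ`: the common kernel of the two
degeneracy push-forwards to level `N⁺/ℓ`. [cite: BertoliniDarmon1999, §2 p. 265 (the two degeneracy maps, covariant/contravariant; quaternionic form, unfolding)] -/
def newSubmoduleAt (O O₁ O₂ : Submodule ℤ D) (ℓ : ℕ) [Fintype (ClassSet O)] :
    Submodule ℤ (ClassSet O → ℤ) :=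
  LinearMap.ker (degeneracyPush O (lowerLeft O₁ O₂ ℓ)).mulVecLin ⊓
    LinearMap.ker (degeneracyPush O (lowerRight O₁ O₂ ℓ)).mulVecLin

/-- Membership in the `ℓ`-new submodule: both push-forwards vanish. [cite: BertoliniDarmon1999, §2 p. 265 (the two degeneracy maps, covariant/contravariant; quaternionic form, unfolding)] -/
theorem mem_newSubmoduleAt_iff (O O₁ O₂ : Submodule ℤ D) (ℓ : ℕ) [Fintype (ClassSet O)]
    (v : ClassSet O → ℤ) : v ∈ newSubmoduleAt O O₁ O₂ ℓ ↔
      degeneracyPush O (lowerLeft O₁ O₂ ℓ) *ᵥ v = 0 ∧ degeneracyPush O (lowerRight O₁ O₂ ℓ) *ᵥ v = 0 := by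
  simp only [newSubmoduleAt, Submodule.mem_inf, LinearMap.mem_ker, Matrix.mulVecLin_apply]

/-- `newSubmodule` is the infimum over the prime factors of `N⁺` of the `ℓ`-new submodules
(definitional). [cite: BertoliniDarmon1999, §2 p. 265 (the two degeneracy maps, covariant/contravariant; quaternionic form, unfolding)] -/
theorem newSubmodule_eq_iInf_newSubmoduleAt (O O₁ O₂ : Submodule ℤ D) (Nplus : ℕ)
    [Fintype (ClassSet O)] :
    newSubmodule O O₁ O₂ Nplus = ⨅ ℓ ∈ Nplus.primeFactors, newSubmoduleAt O O₁ O₂ ℓ := rfl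

/-- The `N⁺`-new submodule lies in the `ℓ`-new submodule for every prime `ℓ ∣ N⁺`. [cite: BertoliniDarmon1999, §2 p. 265 (the two degeneracy maps, covariant/contravariant; quaternionic form, unfolding)] -/
theorem newSubmodule_le_newSubmoduleAt (O O₁ O₂ : Submodule ℤ D) {Nplus ℓ : ℕ}
    [Fintype (ClassSet O)] (hℓ : ℓ ∈ Nplus.primeFactors) :
    newSubmodule O O₁ O₂ Nplus ≤ newSubmoduleAt O O₁ O₂ ℓ :=
  iInf₂_le (f := fun ℓ _ => newSubmoduleAt O O₁ O₂ ℓ) ℓ hℓ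

/-! ### The Hecke matrix at a prime, the full Hecke algebra and the full eigen-lattice -/

open scoped Classical in
/-- **The Hecke matrix at `p`** for the orientation `(O₁, O₂)` and level `N⁺`: `U_p` (`uMatrix`)
if `p ∣ N⁺`, the Brandt matrix `T(p)` otherwise (at `p ∣ N⁻` this is the involution `W_p`, tree
`BrandtMatrixRamified.lean`; W. Zhang's "`T_ℓ` means `U_ℓ` when `ℓ ∣ N`"). [cite: WZhang2014, §3.9 p. 214 and (4.7) p. 218] -/
def heckeAt (O O₁ O₂ : Submodule ℤ D) (Nplus p : ℕ) : Matrix (ClassSet O) (ClassSet O) ℤ :=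
  if p ∣ Nplus then uMatrix O O₁ O₂ p else matrix O p

/-- `heckeAt = U_p` at `p ∣ N⁺`. [cite: WZhang2014, §3.9 p. 214 and §6.1 p. 226 (`𝕋_{N⁺,N⁻}`; unfolding)] -/
theorem heckeAt_of_dvd (O O₁ O₂ : Submodule ℤ D) {Nplus p : ℕ} (h : p ∣ Nplus) :
    heckeAt O O₁ O₂ Nplus p = uMatrix O O₁ O₂ p := by
  rw [heckeAt, if_pos h]

/-- `heckeAt = T(p)` at `p ∤ N⁺`. [cite: WZhang2014, §3.9 p. 214 and §6.1 p. 226 (`𝕋_{N⁺,N⁻}`; unfolding)] -/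
theorem heckeAt_of_not_dvd (O O₁ O₂ : Submodule ℤ D) {Nplus p : ℕ} (h : ¬ p ∣ Nplus) :
    heckeAt O O₁ O₂ Nplus p = matrix O p := by
  rw [heckeAt, if_neg h]

open scoped Classical in
/-- **The full integral Hecke algebra `𝕋_{N⁺,N⁻}`** of the orientation `(O₁, O₂)`: the
`ℤ`-subalgebra of `M_{Cls O}(ℤ)` generated by the Hecke matrices at all primes — `T(p)` for
`p ∤ N⁺` (including `W_q = T(q)` at `q ∣ N⁻`) and `U_p` for `p ∣ N⁺` ("the Hecke algebra
generated over `ℤ` by `T_ℓ`, `(ℓ, N) = 1`, and `U_ℓ` for `ℓ ∣ N` acting on `ℤ[X]`"). [cite: WZhang2014, §3.9 p. 214 and §6.1 p. 226] -/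
def fullHeckeAlgebra (O O₁ O₂ : Submodule ℤ D) (Nplus : ℕ) [Fintype (ClassSet O)] :
    Subalgebra ℤ (Matrix (ClassSet O) (ClassSet O) ℤ) :=
  Algebra.adjoin ℤ {X | ∃ p : ℕ, p.Prime ∧ X = heckeAt O O₁ O₂ Nplus p}

open scoped Classical in
/-- The Hecke matrices at primes lie in the full Hecke algebra. [cite: WZhang2014, §3.9 p. 214 and §6.1 p. 226 (`𝕋_{N⁺,N⁻}`; unfolding)] -/
theorem heckeAt_mem_fullHeckeAlgebra (O O₁ O₂ : Submodule ℤ D) (Nplus : ℕ) [Fintype (ClassSet O)]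
    {p : ℕ} (hp : p.Prime) : heckeAt O O₁ O₂ Nplus p ∈ fullHeckeAlgebra O O₁ O₂ Nplus :=
  Algebra.subset_adjoin ⟨p, hp, rfl⟩

open scoped Classical in
/-- `U_p ∈ 𝕋_{N⁺,N⁻}` for `p ∣ N⁺` prime. [cite: WZhang2014, §3.9 p. 214 and §6.1 p. 226 (`𝕋_{N⁺,N⁻}`; unfolding)] -/
theorem uMatrix_mem_fullHeckeAlgebra (O O₁ O₂ : Submodule ℤ D) {Nplus : ℕ} [Fintype (ClassSet O)]
    {p : ℕ} (hp : p.Prime) (hpN : p ∣ Nplus) : uMatrix O O₁ O₂ p ∈ fullHeckeAlgebra O O₁ O₂ Nplus := by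
  rw [← heckeAt_of_dvd O O₁ O₂ hpN]; exact heckeAt_mem_fullHeckeAlgebra O O₁ O₂ Nplus hp

open scoped Classical in
/-- `T(p) ∈ 𝕋_{N⁺,N⁻}` for `p ∤ N⁺` prime. [cite: WZhang2014, §3.9 p. 214 and §6.1 p. 226 (`𝕋_{N⁺,N⁻}`; unfolding)] -/
theorem matrix_mem_fullHeckeAlgebra (O O₁ O₂ : Submodule ℤ D) {Nplus : ℕ} [Fintype (ClassSet O)]
    {p : ℕ} (hp : p.Prime) (hpN : ¬ p ∣ Nplus) : matrix O p ∈ fullHeckeAlgebra O O₁ O₂ Nplus := by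
  rw [← heckeAt_of_not_dvd O O₁ O₂ hpN]; exact heckeAt_mem_fullHeckeAlgebra O O₁ O₂ Nplus hp

/-- **The full eigen-lattice** of an eigenvalue system `λ`: the vectors `v ∈ ℤ^{Cls O}` with
`heckeAt p · v = λ(p) v` for EVERY prime `p` (`T_p` at `p ∤ N⁺`, `U_p` at `p ∣ N⁺`) — the
tree's `Brandt.eigenLattice` with no excluded prime, for the family `heckeAt`. This is the
integral eigen-line pinned by the FULL Hecke algebra (W. Zhang 2014 (4.7): "`T_ℓ` acts on `φ` by
`a_ℓ(g) mod p` for all `ℓ` (when `ℓ ∣ N`, `T_ℓ` means `U_ℓ`)"). [cite: WZhang2014, (4.7)–(4.8) pp. 218–219] -/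
def fullEigenLattice (O O₁ O₂ : Submodule ℤ D) (Nplus : ℕ) [Fintype (ClassSet O)] (lam : ℕ → ℤ) :
    Submodule ℤ (ClassSet O → ℤ) :=
  eigenLattice 1 (heckeAt O O₁ O₂ Nplus) lam

/-- Membership in the full eigen-lattice: eigenvector of `heckeAt p` for every prime `p`. [cite: WZhang2014, (4.7)–(4.8) pp. 218–219 (unfolding)] -/
theorem mem_fullEigenLattice_iff (O O₁ O₂ : Submodule ℤ D) (Nplus : ℕ) [Fintype (ClassSet O)]
    (lam : ℕ → ℤ) (v : ClassSet O → ℤ) : v ∈ fullEigenLattice O O₁ O₂ Nplus lam ↔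
      ∀ p : ℕ, p.Prime → heckeAt O O₁ O₂ Nplus p *ᵥ v = lam p • v := by
  rw [fullEigenLattice, mem_eigenLattice_iff]
  exact forall₂_congr fun p _ => ⟨fun h => h (Nat.dvd_one.not.mpr (Nat.Prime.one_lt ‹_›).ne'), fun h _ => h⟩

/-- The full eigen-lattice lies in the anemic eigen-lattice of the Brandt matrices away from any
multiple `N` of `N⁺`. [cite: WZhang2014, (4.7)–(4.8) pp. 218–219 (unfolding)] -/
theorem fullEigenLattice_le_eigenLattice (O O₁ O₂ : Submodule ℤ D) {Nplus : ℕ} (N : ℕ)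
    (hN : Nplus ∣ N) [Fintype (ClassSet O)] (lam : ℕ → ℤ) :
    fullEigenLattice O O₁ O₂ Nplus lam ≤ eigenLattice N (matrix O) lam := by
  intro v hv
  rw [mem_fullEigenLattice_iff] at hv
  rw [mem_eigenLattice_iff]
  intro p hp hpN
  have hpN' : ¬ p ∣ Nplus := fun h => hpN (h.trans hN)
  rw [← heckeAt_of_not_dvd O O₁ O₂ hpN']
  exact hv p hp

end Brandt

/-! ### Brandt setups: a chosen orientation and the attached operators -/

namespace Brandt

variable {Nplus Nminus : ℕ} (S : XiSetup Nplus Nminus)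

/-- **The first maximal order of the chosen orientation** of a Brandt setup: `O₁` in a
presentation `S.O = O₁ ∩ O₂` by maximal orders with `[O₁ : S.O] = N⁺`, extracted from
`S.isEichlerOrder` by `Classical.choose` (an orientation in the sense of Bertolini–Darmon 1999
§2; all orientations are conjugate under the Atkin–Lehner normalisers). [cite: BertoliniDarmon1999, §2 p. 267] -/
def XiSetup.O₁ : Submodule ℤ S.D := Classical.choose S.isEichlerOrder

/-- **The second maximal order of the chosen orientation** of a Brandt setup. [cite: BertoliniDarmon1999, §2 p. 267] -/
def XiSetup.O₂ : Submodule ℤ S.D := Classical.choose (Classical.choose_spec S.isEichlerOrder)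

/-- `S.O₁` is a maximal order. [cite: BertoliniDarmon1999, §2 p. 267 (oriented Eichler orders; unfolding)] -/
theorem XiSetup.isMaximalOrder_O₁ : IsMaximalOrder S.D S.O₁ :=
  (Classical.choose_spec (Classical.choose_spec S.isEichlerOrder)).1

/-- `S.O₂` is a maximal order. [cite: BertoliniDarmon1999, §2 p. 267 (oriented Eichler orders; unfolding)] -/
theorem XiSetup.isMaximalOrder_O₂ : IsMaximalOrder S.D S.O₂ :=
  (Classical.choose_spec (Classical.choose_spec S.isEichlerOrder)).2.1

/-- `S.O = S.O₁ ∩ S.O₂`. [cite: BertoliniDarmon1999, §2 p. 267 (oriented Eichler orders; unfolding)] -/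
theorem XiSetup.O_eq_inf : S.O = S.O₁ ⊓ S.O₂ :=
  (Classical.choose_spec (Classical.choose_spec S.isEichlerOrder)).2.2.1

/-- `[S.O₁ : S.O] = N⁺`. [cite: Voight2021, Def. 23.4.1 and 23.4.19 (level = index; unfolding)] -/
theorem XiSetup.relIndex_O_O₁ : S.O.toAddSubgroup.relIndex S.O₁.toAddSubgroup = Nplus :=
  (Classical.choose_spec (Classical.choose_spec S.isEichlerOrder)).2.2.2

/-- `S.O₁` is an order. [cite: BertoliniDarmon1999, §2 p. 267 (oriented Eichler orders; unfolding)] -/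
theorem XiSetup.isOrder_O₁ : IsOrder S.D S.O₁ := S.isMaximalOrder_O₁.1

/-- `S.O₂` is an order. [cite: BertoliniDarmon1999, §2 p. 267 (oriented Eichler orders; unfolding)] -/
theorem XiSetup.isOrder_O₂ : IsOrder S.D S.O₂ := S.isMaximalOrder_O₂.1

/-- `S.O ⊆ S.O₁`. [cite: BertoliniDarmon1999, §2 p. 267 (oriented Eichler orders; unfolding)] -/
theorem XiSetup.O_le_O₁ : S.O ≤ S.O₁ := S.O_eq_inf ▸ inf_le_left

/-- `S.O ⊆ S.O₂`. [cite: BertoliniDarmon1999, §2 p. 267 (oriented Eichler orders; unfolding)] -/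
theorem XiSetup.O_le_O₂ : S.O ≤ S.O₂ := S.O_eq_inf ▸ inf_le_right

/-- `N⁺ S.O₁ ⊆ S.O` (Lagrange in `S.O₁ / S.O`, of order `N⁺`). [cite: Voight2021, Def. 23.4.1 and 23.4.19 (level = index; unfolding)] -/
theorem XiSetup.natCast_smul_mem_O {y : S.D} (hy : y ∈ S.O₁) : (Nplus : ℤ) • y ∈ S.O := by
  have h := AddSubgroup.nsmul_index_mem (S.O.toAddSubgroup.addSubgroupOf S.O₁.toAddSubgroup) ⟨y, hy⟩
  rw [AddSubgroup.mem_addSubgroupOf] at h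
  rw [← AddSubgroup.relIndex, S.relIndex_O_O₁] at h
  rw [natCast_zsmul]
  exact h

/-- `N⁺ ∈ link(S.O₁, S.O₂)`. [cite: Voight2021, Def. 23.4.1 and 23.4.19 (level = index; unfolding)] -/
theorem XiSetup.natCast_mem_link : ((Nplus : ℕ) : S.D) ∈ link S.O₁ S.O₂ :=
  Brandt.natCast_mem_link S.isOrder_O₁.one_mem fun _ hy => S.O_le_O₂ (S.natCast_smul_mem_O hy)

/-- **The operator `U_ℓ` of a Brandt setup** (for its chosen orientation `(S.O₁, S.O₂)`):
`Brandt.uMatrix S.O S.O₁ S.O₂ ℓ` — meaningful at the primes `ℓ ∣ N⁺`. [cite: WZhang2014, §3.9 p. 214] -/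
def XiSetup.uMatrix (ℓ : ℕ) : Matrix (ClassSet S.O) (ClassSet S.O) ℤ := Brandt.uMatrix S.O S.O₁ S.O₂ ℓ

/-- Unfolding of `XiSetup.uMatrix`. [cite: WZhang2014, §3.9 p. 214 and §6.1 p. 226 (`𝕋_{N⁺,N⁻}`; unfolding)] -/
theorem XiSetup.uMatrix_def (ℓ : ℕ) : S.uMatrix ℓ = Brandt.uMatrix S.O S.O₁ S.O₂ ℓ := rfl

/-- `U_ℓ ≤ T(ℓ)` entrywise for a setup (`ℓ ≠ 0`). [cite: WZhang2014, §3.9 p. 214 and §6.1 p. 226 (`𝕋_{N⁺,N⁻}`; unfolding)] -/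
theorem XiSetup.uMatrix_le_matrix {ℓ : ℕ} (hℓ : ℓ ≠ 0) (i j : ClassSet S.O) :
    S.uMatrix ℓ i j ≤ matrix S.O ℓ i j :=
  haveI := S.isAddTorsionFree
  Brandt.uMatrix_le_matrix S.O S.O₁ S.O₂ hℓ i j

/-- **The Hecke matrix of a setup at the prime `p`**: `U_p` if `p ∣ N⁺`, `T(p)` otherwise. [cite: WZhang2014, §3.9 p. 214] -/
def XiSetup.heckeAt (p : ℕ) : Matrix (ClassSet S.O) (ClassSet S.O) ℤ :=
  Brandt.heckeAt S.O S.O₁ S.O₂ Nplus p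

/-- `S.heckeAt p = S.uMatrix p` at `p ∣ N⁺`. [cite: WZhang2014, §3.9 p. 214 and §6.1 p. 226 (`𝕋_{N⁺,N⁻}`; unfolding)] -/
theorem XiSetup.heckeAt_of_dvd {p : ℕ} (h : p ∣ Nplus) : S.heckeAt p = S.uMatrix p :=
  Brandt.heckeAt_of_dvd S.O S.O₁ S.O₂ h

/-- `S.heckeAt p = T(p)` at `p ∤ N⁺`. [cite: WZhang2014, §3.9 p. 214 and §6.1 p. 226 (`𝕋_{N⁺,N⁻}`; unfolding)] -/
theorem XiSetup.heckeAt_of_not_dvd {p : ℕ} (h : ¬ p ∣ Nplus) : S.heckeAt p = matrix S.O p :=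
  Brandt.heckeAt_of_not_dvd S.O S.O₁ S.O₂ h

open scoped Classical in
/-- **The full Hecke algebra `𝕋_{N⁺,N⁻}(S)`** of a Brandt setup: `ℤ[S.heckeAt p : p prime]`,
containing the generators of the anemic algebra `S.heckeAlgebra` of `BrandtEigenAugmentation.lean`
(`Brandt.matrix S.O p`, `p ∤ N⁺N⁻`) together with the `U_p`, `p ∣ N⁺`, and the `W_q = T(q)`,
`q ∣ N⁻`. [cite: WZhang2014, §3.9 p. 214 and §6.1 p. 226] -/
def XiSetup.fullHeckeAlgebra [Fintype (ClassSet S.O)] :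
    Subalgebra ℤ (Matrix (ClassSet S.O) (ClassSet S.O) ℤ) :=
  Brandt.fullHeckeAlgebra S.O S.O₁ S.O₂ Nplus

open scoped Classical in
/-- The Hecke matrices at primes lie in `𝕋_{N⁺,N⁻}(S)`. [cite: WZhang2014, §3.9 p. 214 and §6.1 p. 226 (`𝕋_{N⁺,N⁻}`; unfolding)] -/
theorem XiSetup.heckeAt_mem_fullHeckeAlgebra [Fintype (ClassSet S.O)] {p : ℕ} (hp : p.Prime) :
    S.heckeAt p ∈ S.fullHeckeAlgebra :=
  Brandt.heckeAt_mem_fullHeckeAlgebra S.O S.O₁ S.O₂ Nplus hp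

open scoped Classical in
/-- The anemic generators `T(p)`, `p ∤ N⁺N⁻`, lie in `𝕋_{N⁺,N⁻}(S)`. [cite: WZhang2014, §3.9 p. 214 and §6.1 p. 226 (`𝕋_{N⁺,N⁻}`; unfolding)] -/
theorem XiSetup.matrix_mem_fullHeckeAlgebra [Fintype (ClassSet S.O)] {p : ℕ} (hp : p.Prime)
    (hpN : ¬ p ∣ Nplus * Nminus) : matrix S.O p ∈ S.fullHeckeAlgebra :=
  Brandt.matrix_mem_fullHeckeAlgebra S.O S.O₁ S.O₂ hp fun h => hpN (h.mul_right Nminus)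

/-- **The full eigen-lattice of a setup**: simultaneous integral eigenvectors of all `S.heckeAt p`. [cite: WZhang2014, (4.7)–(4.8) pp. 218–219] -/
def XiSetup.fullEigenLattice [Fintype (ClassSet S.O)] (lam : ℕ → ℤ) : Submodule ℤ (ClassSet S.O → ℤ) :=
  Brandt.fullEigenLattice S.O S.O₁ S.O₂ Nplus lam

/-- Membership in the full eigen-lattice of a setup. [cite: WZhang2014, (4.7)–(4.8) pp. 218–219 (unfolding)] -/
theorem XiSetup.mem_fullEigenLattice_iff [Fintype (ClassSet S.O)] (lam : ℕ → ℤ)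
    (v : ClassSet S.O → ℤ) :
    v ∈ S.fullEigenLattice lam ↔ ∀ p : ℕ, p.Prime → S.heckeAt p *ᵥ v = lam p • v :=
  Brandt.mem_fullEigenLattice_iff S.O S.O₁ S.O₂ Nplus lam v

/-- The full eigen-lattice of a setup lies in the anemic one of `BrandtXi.lean`
(`Brandt.eigenLattice (N⁺N⁻) (Brandt.matrix S.O) λ`). [cite: WZhang2014, (4.7)–(4.8) pp. 218–219 (unfolding)] -/
theorem XiSetup.fullEigenLattice_le_eigenLattice [Fintype (ClassSet S.O)] (lam : ℕ → ℤ) :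
    S.fullEigenLattice lam ≤ eigenLattice (Nplus * Nminus) (matrix S.O) lam :=
  Brandt.fullEigenLattice_le_eigenLattice S.O S.O₁ S.O₂ (Nplus * Nminus) (dvd_mul_right _ _) lam

/-- The Eichler order of level `N⁺/ℓ` above `S.O` obtained by retracting the `O₁`-end at `ℓ`. [cite: VignerasLNM800, Ch. II §2 (ordres d'Eichler de niveau `p^n`, Lemme 2.4; unfolding)] -/
def XiSetup.lowerLeft (ℓ : ℕ) : Submodule ℤ S.D := Brandt.lowerLeft S.O₁ S.O₂ ℓ

/-- The Eichler order of level `N⁺/ℓ` above `S.O` obtained by retracting the `O₂`-end at `ℓ`. [cite: VignerasLNM800, Ch. II §2 (ordres d'Eichler de niveau `p^n`, Lemme 2.4; unfolding)] -/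
def XiSetup.lowerRight (ℓ : ℕ) : Submodule ℤ S.D := Brandt.lowerRight S.O₁ S.O₂ ℓ

/-- `S.O ⊆ S.lowerLeft ℓ`. [cite: VignerasLNM800, Ch. II §2 (ordres d'Eichler de niveau `p^n`, Lemme 2.4; unfolding)] -/
theorem XiSetup.O_le_lowerLeft (ℓ : ℕ) : S.O ≤ S.lowerLeft ℓ :=
  S.O_eq_inf ▸ Brandt.inf_le_lowerLeft S.isOrder_O₁ S.isOrder_O₂ ℓ

/-- `S.O ⊆ S.lowerRight ℓ`. [cite: VignerasLNM800, Ch. II §2 (ordres d'Eichler de niveau `p^n`, Lemme 2.4; unfolding)] -/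
theorem XiSetup.O_le_lowerRight (ℓ : ℕ) : S.O ≤ S.lowerRight ℓ :=
  S.O_eq_inf ▸ Brandt.inf_le_lowerRight S.isOrder_O₁ S.isOrder_O₂ ℓ

/-- `S.lowerLeft ℓ` is an order. [cite: VignerasLNM800, Ch. II §2 (ordres d'Eichler de niveau `p^n`, Lemme 2.4; unfolding)] -/
theorem XiSetup.isOrder_lowerLeft (ℓ : ℕ) : IsOrder S.D (S.lowerLeft ℓ) :=
  haveI := S.isAddTorsionFree
  Brandt.isOrder_lowerLeft S.isOrder_O₁ S.isOrder_O₂ ℓ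

/-- `S.lowerRight ℓ` is an order. [cite: VignerasLNM800, Ch. II §2 (ordres d'Eichler de niveau `p^n`, Lemme 2.4; unfolding)] -/
theorem XiSetup.isOrder_lowerRight (ℓ : ℕ) : IsOrder S.D (S.lowerRight ℓ) :=
  haveI := S.isAddTorsionFree
  Brandt.isOrder_lowerRight S.isOrder_O₁ S.isOrder_O₂ ℓ

/-- The class sets of the level-lowered orders of a setup are finite. [cite: VignerasLNM800, Ch. II §2 (ordres d'Eichler de niveau `p^n`, Lemme 2.4; unfolding)] -/
theorem XiSetup.finite_classSet_lowerLeft (ℓ : ℕ) : Finite (ClassSet (S.lowerLeft ℓ)) :=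
  Brandt.finite_classSet ℚ (S.isOrder_lowerLeft ℓ)

/-- The class sets of the level-lowered orders of a setup are finite. [cite: VignerasLNM800, Ch. II §2 (ordres d'Eichler de niveau `p^n`, Lemme 2.4; unfolding)] -/
theorem XiSetup.finite_classSet_lowerRight (ℓ : ℕ) : Finite (ClassSet (S.lowerRight ℓ)) :=
  Brandt.finite_classSet ℚ (S.isOrder_lowerRight ℓ)

/-- **The `N⁺`-old submodule of a setup** (`ℤ^{Cls S.O}`-vectors coming from level `N⁺/ℓ`,
`ℓ ∣ N⁺`). [cite: BertoliniDarmon1999, §2 p. 265 (the two degeneracy maps, covariant/contravariant; quaternionic form, unfolding)] -/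
def XiSetup.oldSubmodule : Submodule ℤ (ClassSet S.O → ℤ) := Brandt.oldSubmodule S.O S.O₁ S.O₂ Nplus

/-- **The `N⁺`-new quotient of a setup.** [cite: BertoliniDarmon1999, §2 p. 265 (the two degeneracy maps, covariant/contravariant; quaternionic form, unfolding)] -/
def XiSetup.NewQuotient : Type := Brandt.NewQuotient S.O S.O₁ S.O₂ Nplus

/-- **The `N⁺`-new submodule of a setup.** [cite: BertoliniDarmon1999, §2 p. 265 (the two degeneracy maps, covariant/contravariant; quaternionic form, unfolding)] -/
def XiSetup.newSubmodule [Fintype (ClassSet S.O)] : Submodule ℤ (ClassSet S.O → ℤ) :=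
  Brandt.newSubmodule S.O S.O₁ S.O₂ Nplus

/-- **The `ℓ`-old submodule of a setup** (one prime `ℓ`). [cite: BertoliniDarmon1999, §2 p. 265 (the two degeneracy maps, covariant/contravariant; quaternionic form, unfolding)] -/
def XiSetup.oldSubmoduleAt (ℓ : ℕ) : Submodule ℤ (ClassSet S.O → ℤ) :=
  Brandt.oldSubmoduleAt S.O S.O₁ S.O₂ ℓ

/-- **The `ℓ`-new quotient of a setup** (one prime `ℓ`, e.g. `ℓ = p` itself when `p ∣ N⁺`). [cite: BertoliniDarmon1999, §2 p. 265 (the two degeneracy maps, covariant/contravariant; quaternionic form, unfolding)] -/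
def XiSetup.NewQuotientAt (ℓ : ℕ) : Type := Brandt.NewQuotientAt S.O S.O₁ S.O₂ ℓ

/-- **The `ℓ`-new submodule of a setup** (one prime `ℓ`). [cite: BertoliniDarmon1999, §2 p. 265 (the two degeneracy maps, covariant/contravariant; quaternionic form, unfolding)] -/
def XiSetup.newSubmoduleAt [Fintype (ClassSet S.O)] (ℓ : ℕ) : Submodule ℤ (ClassSet S.O → ℤ) :=
  Brandt.newSubmoduleAt S.O S.O₁ S.O₂ ℓ

/-- The `ℓ`-old submodule of a setup lies in its `N⁺`-old submodule (`ℓ ∣ N⁺` prime). [cite: BertoliniDarmon1999, §2 p. 265 (the two degeneracy maps, covariant/contravariant; quaternionic form, unfolding)] -/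
theorem XiSetup.oldSubmoduleAt_le_oldSubmodule {ℓ : ℕ} (hℓ : ℓ ∈ Nplus.primeFactors) :
    S.oldSubmoduleAt ℓ ≤ S.oldSubmodule :=
  Brandt.oldSubmoduleAt_le_oldSubmodule S.O S.O₁ S.O₂ hℓ

/-- The `N⁺`-new submodule of a setup lies in its `ℓ`-new submodule (`ℓ ∣ N⁺` prime). [cite: BertoliniDarmon1999, §2 p. 265 (the two degeneracy maps, covariant/contravariant; quaternionic form, unfolding)] -/
theorem XiSetup.newSubmodule_le_newSubmoduleAt [Fintype (ClassSet S.O)] {ℓ : ℕ}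
    (hℓ : ℓ ∈ Nplus.primeFactors) : S.newSubmodule ≤ S.newSubmoduleAt ℓ :=
  Brandt.newSubmodule_le_newSubmoduleAt S.O S.O₁ S.O₂ hℓ

/-- Membership in the `ℓ`-new submodule of a setup. [cite: BertoliniDarmon1999, §2 p. 265 (the two degeneracy maps, covariant/contravariant; quaternionic form, unfolding)] -/
theorem XiSetup.mem_newSubmoduleAt_iff [Fintype (ClassSet S.O)] (ℓ : ℕ) (v : ClassSet S.O → ℤ) :
    v ∈ S.newSubmoduleAt ℓ ↔ degeneracyPush S.O (S.lowerLeft ℓ) *ᵥ v = 0 ∧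
      degeneracyPush S.O (S.lowerRight ℓ) *ᵥ v = 0 :=
  Brandt.mem_newSubmoduleAt_iff S.O S.O₁ S.O₂ ℓ v

end Brandt

end Literature.NumberTheory.Automorphic

end
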